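import Summits.NavierStokesRegularity.FluidComputer.TypeIConcentrationFace
import Literature.Analysis.FluidPDE.SchefferSingularTimesProofs
import HarnessLib

/-!
# Fluid computer — the level dictionary, CONTINUATION FACE (L50): the realised blow-up is the first singular time
# of a GLOBAL weak flow, whose singular times form an `ℋ^{1/2}`-null set (Leray / Scheffer)

HONEST FRAMING (cell `pub-fluidc`, verbatim): *low prior, high value-of-information experiment on Tao's
machine paradigm; NOT a claim that NS blows up.* Theorem side of the cell; nothing here is evidence of blow-up.
The dictionary's class — maximal smooth solutions `(u, p)` of the unforced Navier–Stokes system on `ℝ³ × [0, T)`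
(`ν > 0`), Leray–Hopf from `u 0` — stops at `T`. Leray's existence theorem and the concatenation of Leray–Hopf
solutions (PROVED in the tree: `IsLerayHopfOn.exists_isGlobalLerayHopf_extension`) continue the flow as a GLOBAL
weak solution; Leray's structure theorem with Scheffer's refinement (PROVED in the tree:
`scheffer_singular_times_holds`) bounds its singular times. Read on the class:

* `exists_global_continuation` (**L50 — WHAT HAPPENS AFTER**): there is a global Leray–Hopf weak solution `w`
  from `u 0`, equal to `u` on `(0, T]`, every point `(t, x)` with `0 < t < T` being regular for `w`, `T` being a
  SINGULAR TIME of `w` (the focus of L33′ is a singular point of `w`), and for every horizon `T₀ > 0` the set of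
  singular times of `w` in `(0, T₀)` having one-half-dimensional Hausdorff measure zero;
* `continuation_face`: the same, compactly.

Reading for the machine paradigm (words): a realised blow-up does not end the flow — it is the FIRST of the
singular times of a global finite-energy weak continuation, and all of them together form a set of Hausdorff
dimension ≤ ½ (in particular of measure zero: the flow is smooth in space at almost every later time). A machine
designed to 're-fire' can do so only on such a thin set of instants. Uniqueness of the continuation is NOT claimed
(open). Necessity/structure only. 0 sorry; no new definitions, no named facts.

## References

* J. Leray, Acta Math. 63 (1934) 193–248, §§31–34. [Leray1934]
* V. Scheffer, Comm. Math. Phys. 55 (1977) 97–112. [Scheffer1976]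
* J. C. Robinson, J. L. Rodrigo, W. Sadowski, CUP 2016, Thm. 8.14, Cor. 8.16. [RobinsonRodrigoSadowski2016]
-/

noncomputable section

open MeasureTheory Set Function Filter Topology Metric
open scoped ENNReal NNReal
open Literature.Analysis.FluidPDE Literature.Analysis.FunctionSpaces
open Summit.NavierStokesRegularity.FluidComputer.LocalisationFace
open Summit.NavierStokesRegularity.FluidComputer.TypeIConcentrationFace

namespace Summit.NavierStokesRegularity.FluidComputer.ContinuationFace

/-- **A backward singular point is not a regular point** (the centred cylinder `Q*_r(T, x₀)` contains the backward
cylinder `Q_r(T, x₀)`, on which the field is essentially unbounded). [cite: Seregin2012, §1] -/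
theorem not_isRegularPoint_of_backward {w : ℝ → EuclideanSpace ℝ (Fin 3) → EuclideanSpace ℝ (Fin 3)}
    {T : ℝ} {x₀ : EuclideanSpace ℝ (Fin 3)} (hT : 0 < T)
    (hsing : ∀ r : ℝ, 0 < r → r ^ 2 < T →
      eLpNorm (uncurry w) ∞ (volume.restrict (parabolicCylinder r ((T : ℝ), x₀))) = ∞) :
    ¬ IsRegularPoint w ((T : ℝ), x₀) := by
  rintro ⟨r, hr, hfin⟩
  -- shrink the radius below `√T`
  set r₁ : ℝ := min r (Real.sqrt T / 2) with hr₁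
  have hr₁pos : 0 < r₁ := lt_min hr (by positivity)
  have hr₁r : r₁ ≤ r := min_le_left _ _
  have hr₁T : r₁ ^ 2 < T := by
    have h1 : r₁ ≤ Real.sqrt T / 2 := min_le_right _ _
    have h2 : (Real.sqrt T / 2) ^ 2 = T / 4 := by rw [div_pow, Real.sq_sqrt hT.le]; norm_num
    calc r₁ ^ 2 ≤ (Real.sqrt T / 2) ^ 2 := pow_le_pow_left₀ hr₁pos.le h1 2
      _ = T / 4 := h2
      _ < T := by linarith
  have hsub : parabolicCylinder r₁ ((T : ℝ), x₀) ⊆ parabolicCylinderCentered r ((T : ℝ), x₀) := by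
    intro z hz
    rw [mem_parabolicCylinder] at hz
    rw [mem_parabolicCylinderCentered]
    have h1 := hz.1.1
    have h2 := hz.1.2
    simp only at h1 h2 ⊢
    refine ⟨⟨by nlinarith [pow_le_pow_left₀ hr₁pos.le hr₁r 2], by nlinarith [pow_pos hr 2]⟩,
      hz.2.trans_le hr₁r⟩
  have hle : eLpNorm (uncurry w) ⊤ (volume.restrict (parabolicCylinder r₁ ((T : ℝ), x₀))) ≤
      eLpNorm (uncurry w) ⊤ (volume.restrict (parabolicCylinderCentered r ((T : ℝ), x₀))) :=
    eLpNorm_mono_measure _ (Measure.restrict_mono hsub le_rfl)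
  rw [hsing r₁ hr₁pos hr₁T, top_le_iff] at hle
  exact hfin.ne hle

/-- **L50 — THE GLOBAL WEAK CONTINUATION AND ITS SINGULAR TIMES.** For `ν > 0`, `T > 0` and every maximal smooth
solution `(u, p)` of the unforced Navier–Stokes system on `ℝ³ × [0, T)` which is Leray–Hopf from `u 0`, there is a
GLOBAL Leray–Hopf weak solution `w` from `u 0` (`IsGlobalLerayHopf`) such that (i) `w t = u t` for all
`t ∈ (0, T]`; (ii) every `(t, x)` with `t ∈ (0, T)` is a regular point of `w`; (iii) `T` is a singular time of `w`
— indeed the focus `x₀` of L33′ gives a non-regular point `(T, x₀)`; (iv) for every `T₀ > 0`,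
`μH[1/2] {t ∈ (0, T₀) | t is a singular time of w} = 0` (Leray–Scheffer, `scheffer_singular_times_holds`).
[cite: Leray1934, §§31–34] [cite: Scheffer1976] [cite: RobinsonRodrigoSadowski2016, Thm. 8.14] -/
theorem exists_global_continuation {ν T : ℝ} (hν : 0 < ν) (hT : 0 < T)
    {u : ℝ → EuclideanSpace ℝ (Fin 3) → EuclideanSpace ℝ (Fin 3)} {p : ℝ → EuclideanSpace ℝ (Fin 3) → ℝ}
    (hmax : IsMaximalSmoothSolution ν 0 u p T) (hLH : IsLerayHopfOn T ν 0 (u 0) u) :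
    ∃ w : ℝ → EuclideanSpace ℝ (Fin 3) → EuclideanSpace ℝ (Fin 3),
      IsGlobalLerayHopf ν 0 (u 0) w ∧ (∀ t ∈ Ioc 0 T, w t = u t) ∧
      (∀ t ∈ Ioo 0 T, ∀ x : EuclideanSpace ℝ (Fin 3), IsRegularPoint w (t, x)) ∧
      (∃ x₀ : EuclideanSpace ℝ (Fin 3),
        (∀ r : ℝ, 0 < r → ∀ M : ℝ, ∃ t ∈ Ioo (T - r ^ 2) T, 0 < t ∧ ∃ x ∈ ball x₀ r, M < ‖u t x‖) ∧
        ¬ IsRegularPoint w ((T : ℝ), x₀)) ∧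
      IsSingularTime w T ∧
      ∀ T₀ : ℝ, 0 < T₀ → μH[(1 / 2 : ℝ)] {t ∈ Ioo 0 T₀ | IsSingularTime w t} = 0 := by
  obtain ⟨w, hw, hwu⟩ := hLH.exists_isGlobalLerayHopf_extension hν hT
  obtain ⟨hreg, hsingw⟩ := regular_and_singular_of_agree hmax.1 hwu
  obtain ⟨x₀, hsing⟩ := exists_singularPoint hν hT hmax hLH
  have hnreg : ¬ IsRegularPoint w ((T : ℝ), x₀) := not_isRegularPoint_of_backward hT (hsingw x₀ hsing)
  exact ⟨w, hw, hwu, hreg, ⟨x₀, hsing, hnreg⟩, ⟨x₀, hnreg⟩,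
    fun T₀ hT₀ => scheffer_singular_times_holds hν hT₀ (hw T₀ hT₀)⟩

/-- **THE CONTINUATION FACE, COMPACTLY**: the blow-up time of a maximal smooth Leray–Hopf solution is a singular
time of a global Leray–Hopf continuation from the same datum, regular at all earlier positive times, whose singular
times in every `(0, T₀)` form an `ℋ^{1/2}`-null set. [cite: Leray1934, §34] [cite: Scheffer1976] -/
theorem continuation_face {ν T : ℝ} (hν : 0 < ν) (hT : 0 < T)
    {u : ℝ → EuclideanSpace ℝ (Fin 3) → EuclideanSpace ℝ (Fin 3)} {p : ℝ → EuclideanSpace ℝ (Fin 3) → ℝ}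
    (hmax : IsMaximalSmoothSolution ν 0 u p T) (hLH : IsLerayHopfOn T ν 0 (u 0) u) :
    ∃ w : ℝ → EuclideanSpace ℝ (Fin 3) → EuclideanSpace ℝ (Fin 3),
      IsGlobalLerayHopf ν 0 (u 0) w ∧ (∀ t ∈ Ioc 0 T, w t = u t) ∧
      (∀ t ∈ Ioo 0 T, ¬ IsSingularTime w t) ∧ IsSingularTime w T ∧
      ∀ T₀ : ℝ, 0 < T₀ → μH[(1 / 2 : ℝ)] {t ∈ Ioo 0 T₀ | IsSingularTime w t} = 0 := by
  obtain ⟨w, hw, hwu, hreg, -, hsingT, hS⟩ := exists_global_continuation hν hT hmax hLH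
  refine ⟨w, hw, hwu, fun t ht => ?_, hsingT, hS⟩
  rintro ⟨x, hx⟩
  exact hx (hreg t ht x)

end Summit.NavierStokesRegularity.FluidComputer.ContinuationFace

end
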